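import Literature.AlgebraicGeometry.Resolution.AbhyankarResidueSeparability
import Literature.AlgebraicGeometry.Resolution.AbhyankarToroidalChartsInertial
import Literature.AlgebraicGeometry.Resolution.ToricChartNormal
import Literature.AlgebraicGeometry.Resolution.GeneralizedStabilityHolds
import HarnessLib

/-!
# Temkin 2013, §5.5 (Abhyankar valuations): discharge of Thm. 5.5.3 and Thm. 5.5.1 (iii)

Topic: `Literature/AlgebraicGeometry/Resolution`. DISCHARGE of three named facts of the
inseparable local uniformization cone — M. Temkin, *Inseparable local uniformization*, J. Algebra
373 (2013) 65–119 = arXiv:0804.1554v3, §5.5: **Thm. 5.5.3** (`Temkin2013_Thm553`,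
`AbhyankarToroidalCharts.lean`: for an Abhyankar valuation, after a finite purely inseparable
extension of the ground field the reduction steps become separable), **Thm. 5.5.1 (iii)**
(`Temkin2013_Thm551iii`, `AbhyankarToroidalCharts.lean`, and its inertial rendering
`Temkin2013_Thm551iii_inertial`, `AbhyankarToroidalChartsEtale.lean`: toroidal charts of
Abhyankar valuations) — each of which the tree had already reduced (PROVED) to the generalized
stability theorem of F.-V. Kuhlmann (Trans. AMS 362 (2010), Thm. 1.1) over a trivially valued
ground field: `Temkin2013_Thm553.of_stability` (`AbhyankarResidueSeparability.lean`),
`Temkin2013_Thm551iii_inertial.of_stability` (`AbhyankarToroidalChartsInertial.lean`) and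
`Temkin2013_Thm551iii.of_inertial` (`ToricChartNormal.lean`). That theorem is now PROVED
(`Kuhlmann2010Stability_holds`, `GeneralizedStabilityHolds.lean`), which closes all three; the
consequence Thm. 5.5.2 (i) for `n = 1` is `Temkin2013Abhyankar_holds`
(`InseparableLocalUniformizationAbhyankarHolds.lean`).

## Content (everything PROVED; no definitions, no new named facts)

* `Temkin2013_Thm553_holds`, `Temkin2013_Thm551iii_inertial_holds`, `Temkin2013_Thm551iii_holds`.

## Sources

* M. Temkin, *Inseparable local uniformization*, J. Algebra 373 (2013) 65–119 =
  arXiv:0804.1554v3: §5.5, Thm. 5.5.1 (iii) (p. 59), Thm. 5.5.3 (p. 61).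
  [Temkin2013]
* F.-V. Kuhlmann, *Elimination of ramification I: The generalized stability theorem*, Trans.
  Amer. Math. Soc. 362 (2010) 5697–5727: Thm. 1.1. [Kuhlmann2010]
-/

noncomputable section

namespace Literature.AlgebraicGeometry.Resolution

universe u

/-- **DISCHARGE of `Temkin2013_Thm553`** (Temkin 2013, Thm. 5.5.3), by
`Temkin2013_Thm553.of_stability` and `Kuhlmann2010Stability_holds`. PROVED.
[cite: Temkin2013, Thm. 5.5.3 (p. 61 of arXiv:0804.1554v3)] [cite: Kuhlmann2010, Thm. 1.1] -/
theorem Temkin2013_Thm553_holds : Temkin2013_Thm553.{u} :=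
  Temkin2013_Thm553.of_stability Kuhlmann2010Stability_holds

/-- **DISCHARGE of `Temkin2013_Thm551iii_inertial`** (Temkin 2013, Thm. 5.5.1 (iii), inertial
rendering), by `Temkin2013_Thm551iii_inertial.of_stability` and `Kuhlmann2010Stability_holds`.
PROVED. [cite: Temkin2013, Thm. 5.5.1 (iii) and its proof (p. 59 of arXiv:0804.1554v3)]
[cite: Kuhlmann2010, Thm. 1.1] -/
theorem Temkin2013_Thm551iii_inertial_holds : Temkin2013_Thm551iii_inertial.{u} :=
  Temkin2013_Thm551iii_inertial.of_stability Kuhlmann2010Stability_holds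

/-- **DISCHARGE of `Temkin2013_Thm551iii`** (Temkin 2013, Thm. 5.5.1 (iii): toroidal charts of
Abhyankar valuations), by `Temkin2013_Thm551iii.of_inertial` (normality of toric charts,
`ToricChartNormal.lean`) and `Temkin2013_Thm551iii_inertial_holds`. PROVED.
[cite: Temkin2013, Thm. 5.5.1 (iii) (p. 59 of arXiv:0804.1554v3)] -/
theorem Temkin2013_Thm551iii_holds : Temkin2013_Thm551iii.{u} :=
  Temkin2013_Thm551iii.of_inertial Temkin2013_Thm551iii_inertial_holds

end Literature.AlgebraicGeometry.Resolution
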